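import Summits.CriticalPhenomena.CardyFormulaZ2.Theorems.CardyBoundaryCoulombGasRectilinearCardyOfClosureDensityLaw
import Summits.CriticalPhenomena.CardyFormulaZ2.Theorems.CardyBoundaryCoulombGasRectilinearCardyLatticeBridge
import Summits.CriticalPhenomena.CardyFormulaZ2.Theorems.CardyBoundaryCoulombGasRectilinearCardyStubUniformiseG
import Summits.CriticalPhenomena.CardyFormulaZ2.Theorems.CardyBoundaryCoulombGasRectilinearCardyStubPointwiseFromEngineG
import HarnessLib

/-!
# `DensityIntegration` (route `CardyBoundaryCoulombGas`, glue item stmt-CriticalPhenomena-14890):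
# the engine implies Cardy's formula on rectilinear polygons — PROVED

`DensityIntegration : BoundaryDefectGaussianR → RectilinearCardy` is the statement that the route's
engine (the boundary Coulomb-gas asymptotics of Baxter–Kelland–Wu leg insertions on closure lattice
polygons, crux `BoundaryDefectGaussianR`, stmt-14132) delivers Cardy's formula for bond percolation on
`ℤ²` at `p = 1/2` in every conformal rectangle with rectilinear boundary (crux `RectilinearCardy`,
stmt-5660). It is exactly what line `excursion-kernel-covariance` of crux `RectilinearCardy` proves:
its skeleton (`Cruxes/RectilinearCardy/Lines/excursion_kernel_covariance.lean`, v13) closes the crux from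
the single stub `stub_engine = BoundaryDefectGaussianR`, every other stub being a landed theorem:

* the lattice bridge `latticeBridge` (…RectilinearCardyLatticeBridge: boundary feet → row blocks →
  matching → event identity → counting, fed by the engine line's regularity, configurations and insertion
  dictionary `s17_dictionary`) — the insertion ratio IS the closure density along good placements;
* the realisation `stub_pointwiseFromEngineG` (engine + bridge ⇒ pointwise closure density law) and the
  uniformisation `stub_uniformiseG` (⇒ the closure density law, uniform on flat windows);
* the composition `rectilinearCardy_of_closureDensityAsymptoticsG` (…RectilinearCardyOfClosureDensityLaw:
  density window law, partition, tightness at the junctions, boundary correspondence, Schwarz extension,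
  continuum tail, flat-marks reduction, passage to the conjunct).

So Cardy's formula for rectilinear domains of bond-`ℤ²` percolation is reduced, in Lean, to the engine
crux alone. [BaxterKellandWu1976, §3–§4; Cardy 1992; Smirnov 2001 for the shape of the argument]
-/

namespace Summit.CriticalPhenomena.CardyFormulaZ2.Theorems

open Summit.CriticalPhenomena.CardyFormulaZ2.Cruxes.RectilinearCardy.ExcursionKernelCovariance

/-- **The engine implies Cardy's formula on rectilinear polygons** (`DensityIntegration`, route item
stmt-CriticalPhenomena-14890): `BoundaryDefectGaussianR → RectilinearCardy`, by line
`excursion-kernel-covariance` of crux `RectilinearCardy` — lattice bridge, realisation, uniformisation,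
composition. [cite: BaxterKellandWu1976, §3–§4] -/
theorem DensityIntegration_proof :
    Summit.CriticalPhenomena.CardyFormulaZ2.Theses.CardyBoundaryCoulombGas.DensityIntegration := fun hE =>
  rectilinearCardy_of_closureDensityAsymptoticsG (stub_uniformiseG (stub_pointwiseFromEngineG hE latticeBridge))

end Summit.CriticalPhenomena.CardyFormulaZ2.Theorems
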